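import Literature.AlgebraicGeometry.Resolution.GRingCriteria
import Literature.AlgebraicGeometry.Resolution.GeometricallyRegularFG
import Literature.AlgebraicGeometry.Resolution.QuasiExcellentFiniteType
import Mathlib.RingTheory.PolynomialAlgebra
import Mathlib.RingTheory.Localization.Algebra
import Mathlib.RingTheory.IsTensorProduct
import Mathlib.RingTheory.Polynomial.Basic
import HarnessLib

/-!
# Grothendieck's theorem on G-rings (Stacks 07PV): reduction to polynomial rings over complete
# local rings

Topic: `Literature/AlgebraicGeometry/Resolution`. The Stacks Project, Tag 07PV (Prop. 15.51.10):
"Let `R` be a G-ring. If `R → S` is essentially of finite type then `S` is a G-ring" — the named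
fact `Stacks07PV` of `QuasiExcellentFiniteType.lean` (and through `stacks07QU_of_stacks07PV` the
named fact `Stacks07QU`, finite type algebras over quasi-excellent rings). This file PROVES the
first half of the printed proof, the reduction to polynomial rings in one variable over complete
Noetherian local rings:

> "Since being a G-ring is a property of the local rings it is clear that a localization of a
> G-ring is a G-ring. … Thus it suffices to show that `S_𝔮` is a G-ring for every finite type
> `R`-algebra `S` and every prime `𝔮` of `S`. Writing `S` as a quotient of `R[x_1, …, x_n]` we see
> from Lemma 15.51.3 that it suffices to prove that `R[x_1, …, x_n]` is a G-ring. By induction on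
> `n` it suffices to prove that `R[x]` is a G-ring. Let `𝔮 ⊂ R[x]` be a maximal ideal. By Lemma
> 15.51.7 it suffices to show that `R[x]_𝔮 → R[x]_𝔮^∧` is regular. If `𝔮` lies over `𝔭 ⊂ R`,
> then we may replace `R` by `R_𝔭`. Hence we may assume that `R` is a Noetherian local G-ring with
> maximal ideal `𝔪` and that `𝔮 ⊂ R[x]` lies over `𝔪`. … Consider the diagram
> `R[x]_𝔮^∧ → (R^∧[x]_{𝔮'})^∧` over `R[x]_𝔮 → R^∧[x]_{𝔮'}`. Since `R` is a G-ring the lower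
> horizontal arrow is regular (as a localization of a base change of the regular ring map
> `R → R^∧`). Suppose we can prove the right vertical arrow is regular. Then it follows that the
> composition `R[x]_𝔮 → (R^∧[x]_{𝔮'})^∧` is regular, and hence the left vertical arrow is regular
> by Lemma 15.42.7. Hence we see that we may assume `R` is a Noetherian complete local ring and `𝔮`
> a prime lying over the maximal ideal of `R`."

Here the remaining statement — for a complete Noetherian local ring `R` and a prime `𝔮` of `R[x]`
over `𝔪_R`, the completion map `R[x]_𝔮 → (R[x]_𝔮)^` is regular (the second half of 07PV: Cohen
structure, Lemmas 15.51.5 and 15.51.9) — enters as an explicit HYPOTHESIS `hcore` of the glue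
theorems (it is not vendored as a fact); everything else is PROVED. We treat every prime `𝔮`
directly (the definition of `IsGRing` quantifies over all primes), so Lemma 15.51.7 is not needed
for the reduction, and we take any prime `𝔮'` of `R^∧[x]` over `𝔮` (one exists by faithful
flatness; its uniqueness is not needed).

## Content (namespace `Literature.AlgebraicGeometry.Resolution`)

* `IsRegularHom.completion_localization_of_liesOver` — the diagram chase (Matsumura's proof of
  Thm. 32.2 (ii), pointwise): `A → B` regular, `P` over `𝔭`, `B_P → (B_P)^` regular ⇒
  `A_𝔭 → (A_𝔭)^` regular.
* `isRegularHom_completion_polynomial_of_local` — the case of a local G-ring `R` and a prime of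
  `R[x]` over `𝔪_R`, from `hcore` for `R^∧` (`R[x] → R^∧[x] = R[x] ⊗_R R^∧` is regular by
  Stacks 07C1, `IsRegularHom.baseChange_of_essFiniteType`, and faithfully flat; the
  `R[x]`-algebra structure of `R^∧[x]` is Mathlib's `Polynomial.algebra`, used locally).
* `isRegularHom_completion_polynomial` — any G-ring `R`, any prime of `R[x]` ("replace `R` by
  `R_𝔭`").
* `IsGRing.polynomial_of_core`, `IsGRing.mvPolynomial_of_core`, `IsGRing.of_finiteType_of_core`,
  `IsGRing.of_essFiniteType_of_core`, and `stacks07PV_of_core : hcore → Stacks07PV`,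
  `stacks07QU_of_core : hcore → Stacks07QU`.

## Sources

* The Stacks Project, Tag 07PV (Proposition 15.51.10) and its proof; Tags 07PT, 07C1, 07QI,
  07NT (the inputs, `GRingCriteria.lean`, `GeometricallyRegularFG.lean`,
  `RegularHomComposition.lean`). [StacksProject]
* H. Matsumura, *Commutative Ring Theory*, CUP 1986, Thm. 32.2 (ii) proof (the diagram), p. 257;
  p. 261 (Grothendieck's theorem, "[G], (7.4.4)"; "[M], Theorem 77"). [Matsumura1987]
-/

noncomputable section

open IsLocalRing Polynomial TensorProduct

namespace Literature.AlgebraicGeometry.Resolution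

universe u

/-! ## The diagram chase of Matsumura's Thm. 32.2 (ii), pointwise -/

/-- **Pointwise form of Matsumura's Thm. 32.2 (ii)** (the commutative diagram of its proof): let
`A → B` be a regular homomorphism of Noetherian rings, `P` a prime of `B` over `𝔭`, and assume
`β : B_P → (B_P)*` is regular. Then `α : A_𝔭 → (A_𝔭)*` is regular: `f : A_𝔭 → B_P` is regular
(a localisation of `A → B → B_P`), so `A_𝔭 → (B_P)*` is regular (Thm. 32.1 (i)); it factors as
`A_𝔭 → (A_𝔭)* → (B_P)*` with `f*` faithfully flat, and Thm. 32.1 (ii) applies.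
[cite: Matsumura1987, Thm. 32.2 (ii), proof] -/
theorem IsRegularHom.completion_localization_of_liesOver {A B : Type u} [CommRing A] [CommRing B]
    [Algebra A B] [IsNoetherianRing A] [IsNoetherianRing B] (hφ : IsRegularHom A B)
    (p : Ideal A) [p.IsPrime] (P : Ideal B) [P.IsPrime] [P.LiesOver p]
    (hβ : IsRegularHom (Localization.AtPrime P)
      (AdicCompletion (maximalIdeal (Localization.AtPrime P)) (Localization.AtPrime P))) :
    IsRegularHom (Localization.AtPrime p)
      (AdicCompletion (maximalIdeal (Localization.AtPrime p)) (Localization.AtPrime p)) := by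
  letI : Algebra (Localization.AtPrime p) (Localization.AtPrime P) :=
    Localization.AtPrime.algebraOfLiesOver p P
  haveI : IsNoetherianRing (Localization.AtPrime p) :=
    IsLocalization.isNoetherianRing p.primeCompl _ inferInstance
  haveI : IsNoetherianRing (Localization.AtPrime P) :=
    IsLocalization.isNoetherianRing P.primeCompl _ inferInstance
  -- `f` is regular: `A → B → B_P` is regular and factors through `A_𝔭`
  have hABP : IsRegularHom A (Localization.AtPrime P) :=
    hφ.comp_isLocalization_right P.primeCompl (Localization.AtPrime P)
  have hf : IsRegularHom (Localization.AtPrime p) (Localization.AtPrime P) :=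
    hABP.of_isLocalization_left p.primeCompl (Localization.AtPrime p) (Localization.AtPrime P)
  haveI : Module.Flat (Localization.AtPrime p) (Localization.AtPrime P) := hf.1
  -- `A_𝔭 → B_P → (B_P)*` is regular
  haveI : IsNoetherianRing (AdicCompletion (maximalIdeal (Localization.AtPrime P))
      (Localization.AtPrime P)) := isNoetherianRing_adicCompletion_maximalIdeal _
  haveI : IsScalarTower (Localization.AtPrime p) (Localization.AtPrime P)
      (AdicCompletion (maximalIdeal (Localization.AtPrime P)) (Localization.AtPrime P)) :=
    IsScalarTower.of_algebraMap_eq fun _ => rfl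
  have hAC : IsRegularHom (Localization.AtPrime p)
      (AdicCompletion (maximalIdeal (Localization.AtPrime P)) (Localization.AtPrime P)) :=
    hf.comp hβ
  -- the factorisation `A_𝔭 → (A_𝔭)* → (B_P)*` through the faithfully flat `f*`
  haveI : IsNoetherianRing (AdicCompletion (maximalIdeal (Localization.AtPrime p))
      (Localization.AtPrime p)) := isNoetherianRing_adicCompletion_maximalIdeal _
  have hle : (maximalIdeal (Localization.AtPrime p)).map
      (algebraMap (Localization.AtPrime p) (Localization.AtPrime P)) ≤
        maximalIdeal (Localization.AtPrime P) :=
    map_maximalIdeal_le_of_isLocalHom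
  letI : Algebra (AdicCompletion (maximalIdeal (Localization.AtPrime p)) (Localization.AtPrime p))
      (AdicCompletion (maximalIdeal (Localization.AtPrime P)) (Localization.AtPrime P)) :=
    (adicCompletionMap (maximalIdeal (Localization.AtPrime p))
      (maximalIdeal (Localization.AtPrime P)) (algebraMap _ _) hle).toAlgebra
  haveI : IsScalarTower (Localization.AtPrime p)
      (AdicCompletion (maximalIdeal (Localization.AtPrime p)) (Localization.AtPrime p))
      (AdicCompletion (maximalIdeal (Localization.AtPrime P)) (Localization.AtPrime P)) :=
    IsScalarTower.of_algebraMap_eq fun a =>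
      (RingHom.congr_fun (adicCompletionMap_comp_algebraMap hle) a).symm
  haveI : Module.FaithfullyFlat
      (AdicCompletion (maximalIdeal (Localization.AtPrime p)) (Localization.AtPrime p))
      (AdicCompletion (maximalIdeal (Localization.AtPrime P)) (Localization.AtPrime P)) :=
    faithfullyFlat_adicCompletionMap hle
  exact IsRegularHom.of_comp_of_faithfullyFlat
    (B := AdicCompletion (maximalIdeal (Localization.AtPrime p)) (Localization.AtPrime p)) hAC

/-! ## The local case: a prime of `R[x]` over the maximal ideal of a local G-ring `R` -/

section Local

variable {R : Type u} [CommRing R] [IsLocalRing R]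

omit [IsLocalRing R] in
/-- A prime `Q'` of `S[x]` over a prime `Q` of `R[x]` (along `R[x] → S[x]` induced by `R → S`)
lies, in `S`, over an ideal containing the image of `Q ∩ R`. [folklore] -/
theorem map_under_le_under_of_comap_eq {S : Type u} [CommRing S] [Algebra R S]
    (Q : Ideal R[X]) (Q' : Ideal S[X]) (hQ : Q'.comap (mapRingHom (algebraMap R S)) = Q) :
    (Q.under R).map (algebraMap R S) ≤ Q'.under S := by
  refine Ideal.map_le_iff_le_comap.mpr fun a ha => ?_
  have hCa : (C a : R[X]) ∈ Q := by
    simpa [Ideal.under_def, Ideal.mem_comap, Polynomial.algebraMap_apply] using ha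
  rw [← hQ, Ideal.mem_comap, Polynomial.coe_mapRingHom, Polynomial.map_C] at hCa
  simpa [Ideal.under_def, Ideal.mem_comap, Polynomial.algebraMap_apply] using hCa

/-- **The local case of the reduction** (Stacks 07PV, proof, "Hence we may assume that `R` is a
Noetherian local G-ring … we may assume `R` is a Noetherian complete local ring"): let `R` be a
Noetherian local G-ring and `𝔮` a prime of `R[x]` over `𝔪_R`; granted the complete local case
`hcore` (for `R^`), the completion map `R[x]_𝔮 → (R[x]_𝔮)^` is regular. Proof: `R[x] → R^[x]`
is regular and faithfully flat; choose `𝔮'` over `𝔮`; it lies over `𝔪_{R^} = 𝔪_R R^`, so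
`R^[x]_{𝔮'} → (R^[x]_{𝔮'})^` is regular by `hcore`, and the diagram chase
(`IsRegularHom.completion_localization_of_liesOver`) concludes.
[cite: StacksProject, Tag 07PV (proof)] -/
theorem isRegularHom_completion_polynomial_of_local
    (hcore : ∀ (S : Type u) [CommRing S] [IsLocalRing S] [IsNoetherianRing S]
      [IsAdicComplete (maximalIdeal S) S] (Q : Ideal S[X]) [Q.IsPrime],
      Q.under S = maximalIdeal S →
        IsRegularHom (Localization.AtPrime Q)
          (AdicCompletion (maximalIdeal (Localization.AtPrime Q)) (Localization.AtPrime Q)))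
    (hR : IsGRing R) (q : Ideal R[X]) [q.IsPrime] (hq : q.under R = maximalIdeal R) :
    IsRegularHom (Localization.AtPrime q)
      (AdicCompletion (maximalIdeal (Localization.AtPrime q)) (Localization.AtPrime q)) := by
  haveI : IsNoetherianRing R := hR.1
  set Rh := AdicCompletion (maximalIdeal R) R
  haveI : IsNoetherianRing Rh := isNoetherianRing_adicCompletion_maximalIdeal R
  -- `R^[x]` as an `R[x]`-algebra (`R^[x] = R[x] ⊗_R R^`)
  letI : Algebra R[X] Rh[X] := Polynomial.algebra R Rh
  -- `R[x] → R^[x]` is regular: the base change of the regular `R → R^` along `R → R[x]`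
  -- (Stacks 07C1, `IsRegularHom.baseChange_of_essFiniteType`)
  have hreg : IsRegularHom R[X] Rh[X] := by
    have h1 : IsRegularHom R[X] (R[X] ⊗[R] Rh) :=
      hR.isRegularHom_adicCompletion.baseChange_of_essFiniteType R[X]
    exact h1.of_algEquiv (Algebra.IsPushout.equiv R R[X] Rh Rh[X])
  -- … and faithfully flat (base change of the faithfully flat `R → R^`)
  haveI : Module.FaithfullyFlat R[X] Rh[X] := by
    haveI : Module.FaithfullyFlat R Rh := Module.FaithfullyFlat.of_flat_of_isLocalHom
    exact Module.FaithfullyFlat.of_linearEquiv (R := R[X]) (N := Rh[X]) (M := R[X] ⊗[R] Rh)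
      (Algebra.IsPushout.equiv R R[X] Rh Rh[X]).symm.toLinearEquiv
  -- a prime `𝔮'` of `R^[x]` over `𝔮`; it lies over `𝔪_{R^} = 𝔪_R R^`
  obtain ⟨q', _, hq'⟩ := Ideal.exists_isPrime_liesOver_of_faithfullyFlat (B := Rh[X]) q
  have hq'm : q'.under Rh = maximalIdeal Rh := by
    have hle : maximalIdeal Rh ≤ q'.under Rh := by
      have hQ : q'.comap (mapRingHom (algebraMap R Rh)) = q := by
        rw [← Polynomial.algebraMap_def, ← Ideal.under_def]
        exact (q'.over_def q).symm
      have h1 := map_under_le_under_of_comap_eq (S := Rh) q q' hQ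
      rw [hq] at h1
      rw [AdicCompletion.maximalIdeal_eq_map]
      exact h1
    exact ((IsLocalRing.maximalIdeal.isMaximal Rh).eq_of_le
      (Ideal.IsPrime.ne_top inferInstance) hle).symm
  -- the complete local case for `R^`, and the diagram chase
  have hβ := hcore Rh q' hq'm
  exact hreg.completion_localization_of_liesOver q q' hβ

end Local

/-! ## Any G-ring `R` and any prime of `R[x]`: "replace `R` by `R_𝔭`" -/

section General

variable {R : Type u} [CommRing R]

/-- **The reduction for an arbitrary G-ring** (Stacks 07PV, proof: "If `𝔮` lies over `𝔭 ⊂ R`,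
then we may replace `R` by `R_𝔭`"): for a G-ring `R` and a prime `𝔮` of `R[x]` over `𝔭`,
`R_𝔭` is a local G-ring, `R_𝔭[x]` is the localisation of `R[x]` at `R ∖ 𝔭`, `𝔮' = 𝔮 R_𝔭[x]` is
a prime over `𝔭R_𝔭` with `R[x]_𝔮 ≅ R_𝔭[x]_{𝔮'}`, and the local case applies.
[cite: StacksProject, Tag 07PV (proof)] -/
theorem isRegularHom_completion_polynomial
    (hcore : ∀ (S : Type u) [CommRing S] [IsLocalRing S] [IsNoetherianRing S]
      [IsAdicComplete (maximalIdeal S) S] (Q : Ideal S[X]) [Q.IsPrime],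
      Q.under S = maximalIdeal S →
        IsRegularHom (Localization.AtPrime Q)
          (AdicCompletion (maximalIdeal (Localization.AtPrime Q)) (Localization.AtPrime Q)))
    (hR : IsGRing R) (q : Ideal R[X]) [q.IsPrime] :
    IsRegularHom (Localization.AtPrime q)
      (AdicCompletion (maximalIdeal (Localization.AtPrime q)) (Localization.AtPrime q)) := by
  haveI : IsNoetherianRing R := hR.1
  -- `𝔭 = 𝔮 ∩ R`, the local G-ring `R_𝔭`, and `R_𝔭[x]`, a localisation of `R[x]`
  set p : Ideal R := q.under R with hp
  set Rp := Localization.AtPrime p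
  have hRp : IsGRing Rp := isGRing_of_isLocalization p.primeCompl hR
  haveI : IsNoetherianRing Rp := hRp.1
  letI : Algebra R[X] Rp[X] := Polynomial.algebra R Rp
  set M : Submonoid R[X] := p.primeCompl.map (C : R →+* R[X]) with hM
  haveI : IsLocalization M Rp[X] := Polynomial.isLocalization p.primeCompl Rp
  -- `𝔮` misses `M`
  have hdisj : Disjoint (M : Set R[X]) (q : Set R[X]) := by
    rw [Set.disjoint_left]
    rintro _ ⟨a, ha, rfl⟩ haq
    refine ha ?_
    change a ∈ p
    rw [hp, Ideal.under_def, Ideal.mem_comap, Polynomial.algebraMap_apply, Algebra.algebraMap_self,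
      RingHom.id_apply]
    exact haq
  -- `𝔮' = 𝔮 R_𝔭[x]` is a prime with `𝔮' ∩ R[x] = 𝔮`, lying over the maximal ideal of `R_𝔭`
  set q' : Ideal Rp[X] := q.map (algebraMap R[X] Rp[X]) with hq'def
  haveI : q'.IsPrime := IsLocalization.isPrime_of_isPrime_disjoint M Rp[X] q ‹_› hdisj
  have hcomap : q'.comap (algebraMap R[X] Rp[X]) = q := by
    rw [← Ideal.under_def]
    exact IsLocalization.under_map_of_isPrime_disjoint M Rp[X] ‹q.IsPrime› hdisj
  haveI : q'.LiesOver q := ⟨by rw [Ideal.under_def, hcomap]⟩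
  have hq'm : q'.under Rp = maximalIdeal Rp := by
    have hle : maximalIdeal Rp ≤ q'.under Rp := by
      have hQ : q'.comap (mapRingHom (algebraMap R Rp)) = q := by
        rw [← Polynomial.algebraMap_def]
        exact hcomap
      rw [← Localization.AtPrime.map_eq_maximalIdeal]
      exact map_under_le_under_of_comap_eq q q' hQ
    exact ((IsLocalRing.maximalIdeal.isMaximal Rp).eq_of_le
      (Ideal.IsPrime.ne_top inferInstance) hle).symm
  -- the local case for `R_𝔭`
  have hloc := isRegularHom_completion_polynomial_of_local hcore hRp q' hq'm
  -- transport along `R[x]_𝔮 ≅ R_𝔭[x]_{𝔮'}` (both are localisations of `R[x]` at `𝔮`)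
  haveI : IsScalarTower R[X] Rp[X] (Localization.AtPrime q') := IsScalarTower.of_algebraMap_eq' rfl
  have hX := IsLocalization.isLocalization_isLocalization_atPrime_isLocalization M
    (Localization.AtPrime q') q'
  have hM' : (q'.comap (algebraMap R[X] Rp[X])).primeCompl = q.primeCompl := by
    ext x
    change x ∉ q'.comap (algebraMap R[X] Rp[X]) ↔ x ∉ q
    rw [hcomap]
  haveI : IsLocalization.AtPrime (Localization.AtPrime q') q := by
    change IsLocalization q.primeCompl _
    rw [← hM']
    exact hX
  let e : Localization.AtPrime q ≃ₐ[R[X]] Localization.AtPrime q' :=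
    IsLocalization.algEquiv q.primeCompl _ _
  letI : Algebra (Localization.AtPrime q') (Localization.AtPrime q) :=
    e.symm.toAlgHom.toRingHom.toAlgebra
  haveI : IsNoetherianRing (Localization.AtPrime q) :=
    IsLocalization.isNoetherianRing q.primeCompl _ inferInstance
  haveI : IsNoetherianRing (Localization.AtPrime q') :=
    IsLocalization.isNoetherianRing q'.primeCompl _ inferInstance
  exact IsRegularHom.completion_of_surjective e.symm.surjective hloc

/-! ## Assembly: polynomial rings, finite type and essentially finite type algebras -/

/-- **`R[x]` is a G-ring for a G-ring `R`**, granted the complete local case `hcore`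
(Stacks 07PV). [cite: StacksProject, Tag 07PV] -/
theorem IsGRing.polynomial_of_core
    (hcore : ∀ (S : Type u) [CommRing S] [IsLocalRing S] [IsNoetherianRing S]
      [IsAdicComplete (maximalIdeal S) S] (Q : Ideal S[X]) [Q.IsPrime],
      Q.under S = maximalIdeal S →
        IsRegularHom (Localization.AtPrime Q)
          (AdicCompletion (maximalIdeal (Localization.AtPrime Q)) (Localization.AtPrime Q)))
    (hR : IsGRing R) : IsGRing R[X] :=
  haveI : IsNoetherianRing R := hR.1
  ⟨inferInstance, fun q _ => isRegularHom_completion_polynomial hcore hR q⟩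

/-- **`R[x_1, …, x_n]` is a G-ring for a G-ring `R`** ("By induction on `n`"), granted `hcore`.
[cite: StacksProject, Tag 07PV] -/
theorem IsGRing.mvPolynomial_of_core
    (hcore : ∀ (S : Type u) [CommRing S] [IsLocalRing S] [IsNoetherianRing S]
      [IsAdicComplete (maximalIdeal S) S] (Q : Ideal S[X]) [Q.IsPrime],
      Q.under S = maximalIdeal S →
        IsRegularHom (Localization.AtPrime Q)
          (AdicCompletion (maximalIdeal (Localization.AtPrime Q)) (Localization.AtPrime Q)))
    (hR : IsGRing R) (n : ℕ) : IsGRing (MvPolynomial (Fin n) R) := by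
  induction n with
  | zero => exact hR.of_ringEquiv (MvPolynomial.isEmptyAlgEquiv R (Fin 0)).toRingEquiv.symm
  | succ n ih =>
    exact (ih.polynomial_of_core hcore).of_ringEquiv (MvPolynomial.finSuccEquiv R n).toRingEquiv.symm

/-- **A finite type algebra over a G-ring is a G-ring** ("Writing `S` as a quotient of
`R[x_1, …, x_n]` we see from Lemma 15.51.3 that it suffices to prove that `R[x_1, …, x_n]` is a
G-ring"), granted `hcore`. [cite: StacksProject, Tag 07PV] -/
theorem IsGRing.of_finiteType_of_core
    (hcore : ∀ (S : Type u) [CommRing S] [IsLocalRing S] [IsNoetherianRing S]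
      [IsAdicComplete (maximalIdeal S) S] (Q : Ideal S[X]) [Q.IsPrime],
      Q.under S = maximalIdeal S →
        IsRegularHom (Localization.AtPrime Q)
          (AdicCompletion (maximalIdeal (Localization.AtPrime Q)) (Localization.AtPrime Q)))
    {A B : Type u} [CommRing A] [CommRing B] [Algebra A B] (hA : IsGRing A)
    (hB : Algebra.FiniteType A B) : IsGRing B := by
  obtain ⟨n, f, hf⟩ := Algebra.FiniteType.iff_quotient_mvPolynomial''.mp hB
  exact isGRing_of_surjective f.toRingHom hf (hA.mvPolynomial_of_core hcore n)

/-- **Stacks 07PV, granted the complete local case**: an essentially finite type algebra over a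
G-ring is a G-ring ("a localization of a G-ring is a G-ring"; `B` is a localisation of a finite
type `A`-subalgebra). [cite: StacksProject, Tag 07PV] -/
theorem IsGRing.of_essFiniteType_of_core
    (hcore : ∀ (S : Type u) [CommRing S] [IsLocalRing S] [IsNoetherianRing S]
      [IsAdicComplete (maximalIdeal S) S] (Q : Ideal S[X]) [Q.IsPrime],
      Q.under S = maximalIdeal S →
        IsRegularHom (Localization.AtPrime Q)
          (AdicCompletion (maximalIdeal (Localization.AtPrime Q)) (Localization.AtPrime Q)))
    {A B : Type u} [CommRing A] [CommRing B] [Algebra A B] (hA : IsGRing A)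
    (hB : Algebra.EssFiniteType A B) : IsGRing B :=
  haveI := hB
  isGRing_of_isLocalization (Algebra.EssFiniteType.submonoid A B)
    (hA.of_finiteType_of_core hcore (B := Algebra.EssFiniteType.subalgebra A B) inferInstance)

/-- **The named fact `Stacks07PV` from the complete local case.** With a proof `hcore` of: "for a
complete Noetherian local ring `S` and a prime `Q` of `S[x]` over `𝔪_S`, `S[x]_Q → (S[x]_Q)^` is
regular" (the second half of the proof of Stacks 07PV), `Stacks07PV` holds.
[cite: StacksProject, Tag 07PV] -/
theorem stacks07PV_of_core
    (hcore : ∀ (S : Type u) [CommRing S] [IsLocalRing S] [IsNoetherianRing S]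
      [IsAdicComplete (maximalIdeal S) S] (Q : Ideal S[X]) [Q.IsPrime],
      Q.under S = maximalIdeal S →
        IsRegularHom (Localization.AtPrime Q)
          (AdicCompletion (maximalIdeal (Localization.AtPrime Q)) (Localization.AtPrime Q))) :
    Stacks07PV.{u} :=
  fun _A _B _ _ _ hA hB => hA.of_essFiniteType_of_core hcore hB

/-- **The named fact `Stacks07QU` from the complete local case** (via `stacks07QU_of_stacks07PV`).
[cite: StacksProject, Tag 07QU] -/
theorem stacks07QU_of_core
    (hcore : ∀ (S : Type u) [CommRing S] [IsLocalRing S] [IsNoetherianRing S]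
      [IsAdicComplete (maximalIdeal S) S] (Q : Ideal S[X]) [Q.IsPrime],
      Q.under S = maximalIdeal S →
        IsRegularHom (Localization.AtPrime Q)
          (AdicCompletion (maximalIdeal (Localization.AtPrime Q)) (Localization.AtPrime Q))) :
    Stacks07QU.{u} :=
  stacks07QU_of_stacks07PV (stacks07PV_of_core hcore)

end General

end Literature.AlgebraicGeometry.Resolution

end
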